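import Mathlib.Geometry.Manifold.LocalDiffeomorph
import HarnessLib

/-!
# Differentiability descends along a (surjective) local diffeomorphism

Topic `Geometry/Manifold`; namespace `Literature.Geometry.Manifold`.  GENERIC manifold lemma (three charted spaces
with three possibly DIFFERENT models `I`, `J`, `K` over one field `𝕜`; no `IsManifold`, no completeness, no
finite dimension): if `π : M → N` is a `Cⁿ` local diffeomorphism at `x` (`n ≠ 0`) and `f : N → P` is any map,
then `f` is differentiable at `π x` as soon as `f ∘ π` is differentiable at `x` — near `π x` one has
`f = (f ∘ π) ∘ σ` for the local inverse `σ` of `π` (Mathlib `IsLocalDiffeomorphAt.localInverse`), which is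
differentiable.  Consequences: the `iff` form, the global form along a SURJECTIVE local diffeomorphism
(`MDifferentiable (f ∘ π) ↔ MDifferentiable f`), and the `MDifferentiableOn` form on `π '' s`.

This is the characteristic property of surjective smooth submersions ([Lee2012] Thm. 4.29, with Prop. 4.8:
a local diffeomorphism is a submersion) in the `C¹`/holomorphic reading Mathlib's `MDifferentiable` carries;
the tree's
`Literature.AnabelianGeometry.AbsoluteAnabelian.mdifferentiableAt_of_comp_eq_of_isLocalDiffeomorphAt`
is the special case `I = J = K` (one model for all three manifolds), which does not serve maps into a manifold
modelled on another space (e.g. `Δ\𝔹² → ℙᵇ(ℂ)^an`, cell hodgecm-mathlib, row #61 node N1).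
Theorems only: no definition, no named fact, no instance, no `sorry`.

## References
* [Lee2012] J. M. Lee, *Introduction to Smooth Manifolds*, 2nd ed., GTM 218 (2012), Prop. 4.8, Thm. 4.29.
-/

noncomputable section

open Function Set Filter
open scoped Manifold ContDiff Topology

namespace Literature.Geometry.Manifold

variable {𝕜 : Type*} [NontriviallyNormedField 𝕜]
  {E : Type*} [NormedAddCommGroup E] [NormedSpace 𝕜 E]
  {F : Type*} [NormedAddCommGroup F] [NormedSpace 𝕜 F]
  {G : Type*} [NormedAddCommGroup G] [NormedSpace 𝕜 G]
  {H₁ : Type*} [TopologicalSpace H₁] {H₂ : Type*} [TopologicalSpace H₂] {H₃ : Type*} [TopologicalSpace H₃]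
  {I : ModelWithCorners 𝕜 E H₁} {J : ModelWithCorners 𝕜 F H₂} {K : ModelWithCorners 𝕜 G H₃}
  {M : Type*} [TopologicalSpace M] [ChartedSpace H₁ M]
  {N : Type*} [TopologicalSpace N] [ChartedSpace H₂ N]
  {P : Type*} [TopologicalSpace P] [ChartedSpace H₃ P]
  {n : WithTop ℕ∞} {π : M → N} {f : N → P} {x : M}

/-- **Differentiability descends along a local diffeomorphism, pointwise.**  If `π` is a `Cⁿ` local
diffeomorphism at `x` (`n ≠ 0`) and `f ∘ π` is differentiable at `x`, then `f` is differentiable at `π x`: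
`f = (f ∘ π) ∘ σ` near `π x` for the local inverse `σ` of `π` at `x`.
[cite: Lee2012, Thm. 4.29 with Prop. 4.8] -/
theorem mdifferentiableAt_of_isLocalDiffeomorphAt_comp (hπ : IsLocalDiffeomorphAt I J n π x) (hn : n ≠ 0)
    (hf : MDifferentiableAt I K (f ∘ π) x) : MDifferentiableAt J K f (π x) := by
  have h1 : MDifferentiableAt I K (f ∘ π) (hπ.localInverse (π x)) := by
    rwa [hπ.localInverse_left_inv hπ.localInverse_mem_target]
  have h2 : MDifferentiableAt J K ((f ∘ π) ∘ hπ.localInverse) (π x) :=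
    h1.comp _ (hπ.localInverse_mdifferentiableAt hn)
  refine h2.congr_of_eventuallyEq ?_
  filter_upwards [hπ.localInverse_eventuallyEq_right] with y hy
  simp only [Function.comp_apply, id_eq] at hy ⊢
  rw [hy]

/-- Same, with the composite given by an equation `f ∘ π = t`. [cite: Lee2012, Thm. 4.29 with Prop. 4.8] -/
theorem mdifferentiableAt_of_isLocalDiffeomorphAt_comp_eq (hπ : IsLocalDiffeomorphAt I J n π x) (hn : n ≠ 0)
    {t : M → P} (ht : MDifferentiableAt I K t x) (h : f ∘ π = t) : MDifferentiableAt J K f (π x) :=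
  mdifferentiableAt_of_isLocalDiffeomorphAt_comp hπ hn (h ▸ ht)

/-- **`iff` form at a point of a local diffeomorphism.** [cite: Lee2012, Thm. 4.29 with Prop. 4.8] -/
theorem mdifferentiableAt_comp_iff_of_isLocalDiffeomorphAt (hπ : IsLocalDiffeomorphAt I J n π x) (hn : n ≠ 0) :
    MDifferentiableAt I K (f ∘ π) x ↔ MDifferentiableAt J K f (π x) :=
  ⟨mdifferentiableAt_of_isLocalDiffeomorphAt_comp hπ hn, fun hf => hf.comp x (hπ.mdifferentiableAt hn)⟩

/-- **Global form along a SURJECTIVE local diffeomorphism** (characteristic property of surjective smooth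
submersions, differentiable reading): `f ∘ π` differentiable ⇒ `f` differentiable.
[cite: Lee2012, Thm. 4.29 with Prop. 4.8] -/
theorem mdifferentiable_of_isLocalDiffeomorph_comp (hπ : IsLocalDiffeomorph I J n π) (hn : n ≠ 0)
    (hsurj : Surjective π) (hf : MDifferentiable I K (f ∘ π)) : MDifferentiable J K f := fun y => by
  obtain ⟨x, rfl⟩ := hsurj y
  exact mdifferentiableAt_of_isLocalDiffeomorphAt_comp (hπ x) hn (hf x)

/-- **Global `iff` along a surjective local diffeomorphism**: `MDifferentiable (f ∘ π) ↔ MDifferentiable f`.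
[cite: Lee2012, Thm. 4.29 with Prop. 4.8] -/
theorem mdifferentiable_comp_iff_of_isLocalDiffeomorph (hπ : IsLocalDiffeomorph I J n π) (hn : n ≠ 0)
    (hsurj : Surjective π) : MDifferentiable I K (f ∘ π) ↔ MDifferentiable J K f :=
  ⟨mdifferentiable_of_isLocalDiffeomorph_comp hπ hn hsurj, fun hf => hf.comp (hπ.mdifferentiable hn)⟩

/-- Same, with the composite given by an equation `f ∘ π = t`. [cite: Lee2012, Thm. 4.29 with Prop. 4.8] -/
theorem mdifferentiable_of_isLocalDiffeomorph_comp_eq (hπ : IsLocalDiffeomorph I J n π) (hn : n ≠ 0)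
    (hsurj : Surjective π) {t : M → P} (ht : MDifferentiable I K t) (h : f ∘ π = t) :
    MDifferentiable J K f :=
  mdifferentiable_of_isLocalDiffeomorph_comp hπ hn hsurj (h ▸ ht)

/-- **Image form**: along a local diffeomorphism, `f` is differentiable at every point of `π '' s` as soon as
`f ∘ π` is differentiable at every point of `s` (pointwise `MDifferentiableAt`, the form open sets use).
[cite: Lee2012, Thm. 4.29 with Prop. 4.8] -/
theorem forall_mdifferentiableAt_image_of_isLocalDiffeomorph (hπ : IsLocalDiffeomorph I J n π) (hn : n ≠ 0)
    {s : Set M} (hf : ∀ x ∈ s, MDifferentiableAt I K (f ∘ π) x) :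
    ∀ y ∈ π '' s, MDifferentiableAt J K f y := by
  rintro _ ⟨x, hx, rfl⟩
  exact mdifferentiableAt_of_isLocalDiffeomorphAt_comp (hπ x) hn (hf x hx)

/-- **`MDifferentiableOn` form on an open set**: if `s` is open and `f ∘ π` is differentiable on `s`, then `f`
is differentiable on the (open) set `π '' s`. [cite: Lee2012, Thm. 4.29 with Prop. 4.8] -/
theorem mdifferentiableOn_image_of_isLocalDiffeomorph (hπ : IsLocalDiffeomorph I J n π) (hn : n ≠ 0)
    {s : Set M} (hs : IsOpen s) (hf : MDifferentiableOn I K (f ∘ π) s) :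
    MDifferentiableOn J K f (π '' s) := by
  rintro _ ⟨x, hx, rfl⟩
  exact (mdifferentiableAt_of_isLocalDiffeomorphAt_comp (hπ x) hn
    (hf.mdifferentiableAt (hs.mem_nhds hx))).mdifferentiableWithinAt

end Literature.Geometry.Manifold

end
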